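import Literature.AnabelianGeometry.EtaleTheta.Discharge.Sec5Thm57HCOfEtaleRigidity

/-!
# [EtTh] §5, Theorem 5.7: the per-level clause of `hrigid` («`w_N` is an `N`-th root of ONE `ζ ∈ μ_{2l}(K)` up to a `Π_Y`-fixed unit») from the étale-side inputs (pp. 328–331 / PDF pp. 102–105)

Mochizuki, *The étale theta function and its Frobenioid-theoretic manifestations*, Publ. RIMS **45** (2009)
[cite: MochizukiEtTh2009, Thm 5.7 proof p.330 (PDF p.104); Thm 5.6 p.328 (PDF p.102); Cor 2.8 (i) p.268 (PDF p.42); Prop 5.2 (iii)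
p.324 (PDF p.98); Lem 5.8 p.331 (PDF p.105)].  Print (Thm. 5.7): «`Ψ` preserves `N`-th roots of theta pairs, up to possible
multiplication by a `2l`-th root of unity» — proof p.330: «by applying the rigidity of the étale theta function [Cor. 2.8 (i)] to the
Kummer classes of Prop. 5.2 (iii) … in light of … Prop. 5.5, which, by Thm. 5.6, are preserved by `Ψ`».
Seat abc-iut-L2-d4 (gen 5; node `EtTh:Thm5.7`, abc-iut-L2-lead R408/R532 «(C)-junction composer», junction note J-C5).  PROOF-ONLY
(0 definitions) over my `Sec5Thm57HCOfEtaleRigidity.lean` (p453757) and `Sec5Thm57RigidOfKummerComparison.lean` (p448195).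

THE POINT (J-C5, R532).  The (C)-binder `hrigid` of `thetaRootPreservedAll_ofConnectedTemperoidYddFamily_final_of_kummerRigid`
(p446712) asks, at every level `N` and for every NORMALISED transport datum `(a, b, w)` of `(s^⊓_N, s^⊔_N)` (`hT`: `a⁻¹Ψ(s^⊓)b = s^⊓`,
`hT′`: `a⁻¹Ψ(s^⊔)b = s^⊔ ≫ w`, `w ∈ O^×(B_N)`), for a unit `ξ ∈ O^×(B_N)` with
  (fix) `w·ξ⁻¹` is `Π_Y`-fixed, and (tor) `ξ^N = ζ` in `O^×(B_N^birat)` for ONE `ζ ∈ μ_{2l}(K)`.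
p448195 gives (fix) from the Kummer comparison `HC`, and p453757 gives `HC` from the five étale-side inputs (pin) [abc-iut-L2-t4,
landed], (K4m) [abc-iut-L2-t9 R479 from abc-iut-w5-d034's K4β — by conjugation, any `m`], (C5ét) + (κreal) [R-C5, abc-iut-w6-d049
R535], (shadow).  Since `HC` with `ξ := w` is tautological, the CONTENT of (C) is (tor): R-C5 must realise its cocycle `κ` (Cor. 2.8 (i)
under the translation-freeness binder «`τ(γ̃) = 0`», R532) by the SPECIFIC unit
  `ξ := m⁻¹(c) · ζroot`,  `c ∈ μ_N` (the coboundary part `∂c`, realised by Lemma 5.8's cyclotomic character law) and `ζroot ∈ O^×(B_N)`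
  an `N`-th root of the constant `ζ` (`(O_K^×)^{1/N} ⊆ O^×(B_N)`, p.331; the Kummer character `χ_ζ` of `ζ`).
`ThetaFrobenioid.exists_torsionRoot_isFixed_of_thetaSectionCompat` : those inputs, with (κreal) stated AT `ξ := m⁻¹(c)·ζroot` and
`ζroot^N = z` in `O^×(B_N^birat)`, give VERBATIM the per-level clause of `hrigid`: `∃ ξ ∈ O^×(B_N), ξ^N = z ∧ w·ξ⁻¹ Π_Y-fixed`
((tor) because `m⁻¹(c) ∈ μ_N(B_N)` dies under `(-)^N`).  The consumer instantiates `z := constEmb_N ζ`; with ONE `ζ ∈ μ_{2l}(K)` for all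
`N` this is `hrigid`, whence `c^{2l} = 1` (p445072) and Thm. 5.7 (p446712 / `…_final_v3`).
HONEST FRAMING: kernel-checked composition; none of (pin)/(K4m)/(C5ét)/(κreal)/(shadow) is proved here, nor the translation-freeness
that makes (κreal) at a torsion `ξ` consistent ((T-div), R532, abc-iut-w5-d245); nothing of [EtTh] is asserted unconditionally;
typed ≠ discharged; no side taken on anything downstream ([IUTchIII] Cor. 3.12 in particular). -/

namespace Literature.AnabelianGeometry.EtaleTheta

open CategoryTheory

universe w v v' u u'

namespace ThetaFrobenioid

variable {C : Type u} [Category.{v} C] {D : Type u'} [Category.{v'} D] {𝔉 : ThetaFrobenioid.{w} C D}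

/-- **Torsion bookkeeping**: for `u ∈ μ_N(B_N)` and `ζroot ∈ O^×(B_N)`, the unit `u·ζroot` has the same `N`-th power as `ζroot` in
`O^×(B_N^birat)` (`u^N = 1`).  [cite: MochizukiEtTh2009, Lem 5.8 p.331 (PDF p.105)] -/
theorem unitsToBirat_muTorsion_mul_pow (u : 𝔉.muTorsion 𝔉.BN 𝔉.N) {ζroot : Aut 𝔉.BN} (hζu : ζroot ∈ 𝔉.units 𝔉.BN) :
    𝔉.unitsToBirat 𝔉.BN ⟨(u : Aut 𝔉.BN) * ζroot, mul_mem (𝔉.muTorsion_le_units _ _ u.2) hζu⟩ ^ (𝔉.N : ℕ) =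
      𝔉.unitsToBirat 𝔉.BN ⟨ζroot, hζu⟩ ^ (𝔉.N : ℕ) := by
  have hsplit : (⟨(u : Aut 𝔉.BN) * ζroot, mul_mem (𝔉.muTorsion_le_units _ _ u.2) hζu⟩ : 𝔉.pre.unitsSubgroup 𝔉.BN) =
      ⟨(u : Aut 𝔉.BN), 𝔉.muTorsion_le_units _ _ u.2⟩ * ⟨ζroot, hζu⟩ := Subtype.ext rfl
  have htor : (⟨(u : Aut 𝔉.BN), 𝔉.muTorsion_le_units _ _ u.2⟩ : 𝔉.pre.unitsSubgroup 𝔉.BN) ^ (𝔉.N : ℕ) = 1 :=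
    Subtype.ext (by rw [Subgroup.coe_pow, Subgroup.coe_one]; exact (𝔉.mem_muTorsion.mp u.2).2)
  rw [hsplit, map_mul, mul_pow, ← map_pow, htor, map_one, one_mul]

/-- **The per-level clause of `hrigid` from the étale-side inputs** (J-C5 / R532).  Data: the §5 facts `H`, the factorisation `hfac`
(GAP G-L2d4-1), a NORMALISED transport datum `(a, b, e, w)` of `(s^⊓_N, s^⊔_N)` with `s^trv_N` transported over the base shadow `θ`
(`hT`, `hT′`, `hstrv`, `hYdd`, `w ∈ O^×(B_N)`), the dictionary `(T, ι, m, η)` with the pin (Prop. 5.2 (iii)), the étale action `(γ, γ_Δ)`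
with (K4m) (Thm. 5.6) and (shadow), R-C5's cocycle `κ` with (C5ét) (Cor. 2.8 (i)) REALISED by `ξ := m⁻¹(c)·ζroot` (κreal), and
`ζroot^N = z` in `O^×(B_N^birat)`.  Conclusion — VERBATIM the level-`N` clause of `hrigid` with `constEmb_N ζ := z`:
`∃ ξ ∈ O^×(B_N), ξ^N = z ∧ ∀ y ∈ Π_Y, s^⊓-gp_N(y)·(w·ξ⁻¹)·s^⊓-gp_N(y)⁻¹ = w·ξ⁻¹`.
[cite: MochizukiEtTh2009, Thm 5.7 proof p.330 (PDF p.104); Thm 5.6 p.328 (PDF p.102); Cor 2.8 (i) p.268 (PDF p.42); Lem 5.8 p.331 (PDF p.105)] -/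
theorem exists_torsionRoot_isFixed_of_thetaSectionCompat [Epi 𝔉.sCup] (H : 𝔉.Facts)
    (hfac : ∀ y ∈ 𝔉.imPiY, ∃ x ∈ 𝔉.HB, ∀ u ∈ 𝔉.units 𝔉.BN,
      𝔉.sgpCap y * u * (𝔉.sgpCap y)⁻¹ = 𝔉.sgpCap x * u * (𝔉.sgpCap x)⁻¹)
    -- the dictionary and the pin (Prop. 5.2 (iii))
    (T : ThetaEnvData.{v} 𝔉.N) (ι : 𝔉.PiX ≃* T.PiX) (m : 𝔉.muTorsion 𝔉.BN 𝔉.N ≃* T.mu) (hι : 𝔉.IdentifiesPiYdd T ι)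
    {η : T.PiYdd → T.mu} (hpin : 𝔉.ThetaSectionCompat H T ι m hι η)
    -- the normalised transport datum over the base shadow `θ`
    (Ψ : C ≌ C) (α : Ψ.functor.obj 𝔉.AN ≅ 𝔉.AN) (β : Ψ.functor.obj 𝔉.BN ≅ 𝔉.BN) (e : 𝔉.AN ≅ 𝔉.AN) (w : Aut 𝔉.BN)
    (θ : Aut (𝔉.base.obj 𝔉.BN) ≃* Aut (𝔉.base.obj 𝔉.BN)) (hYdd : 𝔉.HB.map θ.toMonoidHom = 𝔉.HB)
    (hT : α.inv ≫ Ψ.functor.map 𝔉.sCap ≫ β.hom = e.hom ≫ 𝔉.sCap ≫ (1 : Aut 𝔉.BN).hom)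
    (hT' : α.inv ≫ Ψ.functor.map 𝔉.sCup ≫ β.hom = e.hom ≫ 𝔉.sCup ≫ w.hom)
    (hstrv : ∀ g : Aut (𝔉.base.obj 𝔉.BN),
      α.inv ≫ Ψ.functor.map (𝔉.strv (𝔉.autBaseIsoAB.symm g)).hom ≫ α.hom ≫ e.hom =
        e.hom ≫ (𝔉.strv (𝔉.autBaseIsoAB.symm (θ g))).hom)
    (hw : w ∈ 𝔉.units 𝔉.BN)
    -- the étale action, R-C5's cocycle, and its realising unit `ξ := m⁻¹(c)·ζroot`
    (γ : T.PiX → T.PiX) (hγ : ∀ x : T.PiX, x ∈ T.PiYdd → γ x ∈ T.PiYdd) (γΔ : T.mu → T.mu) (κ : T.PiYdd → T.mu)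
    (c : T.mu) {ζroot : Aut 𝔉.BN} (hζu : ζroot ∈ 𝔉.units 𝔉.BN) {z : 𝔉.biratUnits 𝔉.BN}
    (hζ : 𝔉.unitsToBirat 𝔉.BN ⟨ζroot, hζu⟩ ^ (𝔉.N : ℕ) = z)
    (hshadow : ∀ k : 𝔉.PiYdd, θ (𝔉.ρ k) = 𝔉.ρ (ι.symm (γ (ι k))))
    (hK4 : ∀ x : T.mu, 𝔉.psiAut Ψ β ((m.symm x : 𝔉.muTorsion 𝔉.BN 𝔉.N) : Aut 𝔉.BN) =
      ((m.symm (γΔ x) : 𝔉.muTorsion 𝔉.BN 𝔉.N) : Aut 𝔉.BN))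
    (hC5 : ∀ k : T.PiYdd, γΔ (η k) = η ⟨γ k, hγ k k.2⟩ * κ ⟨γ k, hγ k k.2⟩)
    (hκ : ∀ k : 𝔉.PiYdd, ((m.symm (κ ⟨ι k, (hι k).mp k.2⟩) : 𝔉.muTorsion 𝔉.BN 𝔉.N) : Aut 𝔉.BN) =
      𝔉.sgpCup (𝔉.rhoYdd k) * (((m.symm c : 𝔉.muTorsion 𝔉.BN 𝔉.N) : Aut 𝔉.BN) * ζroot) * (𝔉.sgpCup (𝔉.rhoYdd k))⁻¹ *
        (((m.symm c : 𝔉.muTorsion 𝔉.BN 𝔉.N) : Aut 𝔉.BN) * ζroot)⁻¹) :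
    ∃ ξ : 𝔉.units 𝔉.BN, 𝔉.unitsToBirat 𝔉.BN ξ ^ (𝔉.N : ℕ) = z ∧
      ∀ y ∈ 𝔉.imPiY, 𝔉.sgpCap y * (w * (ξ : Aut 𝔉.BN)⁻¹) * (𝔉.sgpCap y)⁻¹ = w * (ξ : Aut 𝔉.BN)⁻¹ := by
  haveI : Epi 𝔉.sCap := H.epi_sCap
  have hξ : ((m.symm c : 𝔉.muTorsion 𝔉.BN 𝔉.N) : Aut 𝔉.BN) * ζroot ∈ 𝔉.units 𝔉.BN :=
    mul_mem (𝔉.muTorsion_le_units _ _ (m.symm c).2) hζu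
  have HC := kummerComparison_of_thetaSectionCompat H T ι m hι hpin Ψ β θ hYdd
    (((m.symm c : 𝔉.muTorsion 𝔉.BN 𝔉.N) : Aut 𝔉.BN) * ζroot) γ hγ γΔ κ hshadow hK4 hC5 hκ
  refine ⟨⟨_, hξ⟩, ?_, isFixed_discrepancy_of_kummerComparison Ψ α β e w _ θ H.sgpCapSpec H.sgpCupSpec H.biKummerDifferenceMem
    hfac hT hT' hstrv hYdd hw hξ HC⟩
  rw [← hζ]
  exact unitsToBirat_muTorsion_mul_pow (m.symm c) hζu

end ThetaFrobenioid

end Literature.AnabelianGeometry.EtaleTheta
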